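import Mathlib
import HarnessLib
import Summits.QuantumFields.YangMills.Theorems.PencilRigidityCurvatureKernelBoundSwapOffDiagonalInfiniteVolumeCS
import Summits.QuantumFields.YangMills.Theorems.PencilRigidityCurvatureKernelBoundTorusInfiniteVolumeComparison
import Summits.QuantumFields.YangMills.Theorems.PencilRigidityCurvatureKernelBoundTwoPointLocalBoundSemiDegenerate
import Summits.QuantumFields.YangMills.Theorems.PencilRigidityCurvatureKernelBoundFiniteCouplingStrongTempered
import Literature.MathematicalPhysics.QuantumFieldTheory.YangMillsOS

/-!
# `CurvatureKernelBound` — brick `SwapOffDiagonalVanishing` of lead c10's swap-mirror programme toward `Stub.FiniteCouplingStrongSubextensive`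
# (crux stmt-QuantumFields-11687, line `coupling-trichotomy`, skeleton v9, wave 3)

Along a scaling scheme `sch` (spacing `a_k → 0`, box half-side `L_k` with `a_k L_k → ∞`, couplings
`0 ≤ β_k ≤ β' < β₁/4` eventually, curvature renormalisation `c_k` with the sub-extensive rate
`c_k² e^{−κ(L_k − T/a_k)} → 0`), write `T^T_k(f, h) = LS₂(![f, h]) − LS₁(f) LS₁(h)` for the truncated
renormalised lattice two-point function of the curvature on the torus, and
`T^∞_k(f, h) = c_k² a_k⁸ Σ_{x,y} f(a_k x) h(a_k y) (P_{β_k}(y − x) − q_{β_k}²)` for its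
infinite-volume model built from the box limits `q, P` of the free-boundary strong-coupling states
(hypothesis `hF5`).  HYPOTHESIS `hA` (sibling `SwapDiagonalVanishing`): `T^T_k(g ∘ swap, g) → 0` for
every `g` supported in a half space `{δ ≤ z 0 − z 1} ∩ B̄(0, T)`.  CLAIM: `T^T_k(f₀, f₁) → 0` whenever
`f₀` is supported in `{z 0 − z 1 ≤ −δ} ∩ B̄(0, T)` and `f₁` in `{δ ≤ z 0 − z 1} ∩ B̄(0, T)`.

Proof.  (1) The mirror images `f₀θ = f₀ ∘ swap`, `f₁θ = f₁ ∘ swap` are Schwartz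
(`SchwartzMap.compCLMOfContinuousLinearEquiv` with the coordinate-swap isometry); `hA` gives
`T^T_k(f₁θ, f₁) → 0` and `T^T_k(f₀, f₀θ) → 0`.  (2) `TorusInfiniteVolumeComparison` (fed with the
finite-size rate `hFS`) and the sub-extensive rate give `T^T_k(f, h) − T^∞_k(f, h) → 0` for every pair
supported in `B̄(0, T)` (lattice point count `a⁴ Σ |f(a x)| ≤ (3T)⁴ sup|f|`), so
`T^∞_k(f₁θ, f₁) → 0`, `T^∞_k(f₀, f₀θ) → 0`.  (3) Reflection positivity of the infinite-volume state
across the diagonal mirror (`SwapOffDiagonalInfiniteVolumeCS`) gives, for large `k`,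
`T^∞_k(f₀, f₁)² ≤ T^∞_k(f₁θ, f₁) T^∞_k(f₀, f₀θ)`, hence `T^∞_k(f₀, f₁) → 0` and finally
`T^T_k(f₀, f₁) → 0` by (2).
-/

noncomputable section

open scoped BigOperators Topology SchwartzMap
open MeasureTheory Filter Set
open Literature.MathematicalPhysics.QuantumLattice Literature.MathematicalPhysics.QuantumFieldTheory
  Literature.Probability.LatticeModels

namespace Summit.QuantumFields.YangMills.Theorems.CurvatureKernel

namespace SwapOffDiag

/-! ## The mirror image of a test function under the coordinate swap `z 0 ↔ z 1` -/

/-- The mirror image `f ∘ swap` of a Schwartz function is a Schwartz function (composition with the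
coordinate-swap linear isometry). [folklore] -/
theorem exists_schwartz_swap (f : 𝓢(EuclideanSpace ℝ (Fin 4), ℝ)) :
    ∃ g : 𝓢(EuclideanSpace ℝ (Fin 4), ℝ), ∀ z : EuclideanSpace ℝ (Fin 4),
      g z = f (WithLp.toLp 2 (fun i => z (Equiv.swap (0 : Fin 4) 1 i))) :=
  ⟨SchwartzMap.compCLMOfContinuousLinearEquiv ℝ
    (LinearIsometryEquiv.piLpCongrLeft 2 ℝ ℝ (Equiv.swap (0 : Fin 4) 1)).toContinuousLinearEquiv f,
    fun _ => rfl⟩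

/-- The coordinate swap is an involution of `ℝ⁴`. [folklore] -/
theorem swapE_swapE (z : EuclideanSpace ℝ (Fin 4)) :
    (WithLp.toLp 2 (fun i => (WithLp.toLp 2 (fun i => z (Equiv.swap (0 : Fin 4) 1 i)) :
      EuclideanSpace ℝ (Fin 4)) (Equiv.swap (0 : Fin 4) 1 i)) : EuclideanSpace ℝ (Fin 4)) = z := by
  ext i
  simp [Equiv.swap_apply_self]

/-- The coordinate swap of a rescaled lattice site is the rescaled swapped site. [folklore] -/
theorem swapE_smul_siteToE (a : ℝ) (x : Site 4) :
    (WithLp.toLp 2 (fun i => (a • siteToE x : EuclideanSpace ℝ (Fin 4)) (Equiv.swap (0 : Fin 4) 1 i))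
      : EuclideanSpace ℝ (Fin 4)) = a • siteToE (x ∘ Equiv.swap (0 : Fin 4) 1) := by
  ext i
  simp [siteToE_apply]

/-- The mirror relation is symmetric: `g = gθ ∘ swap`. [folklore] -/
theorem mirror_symm {g gθ : 𝓢(EuclideanSpace ℝ (Fin 4), ℝ)}
    (hθ : ∀ z : EuclideanSpace ℝ (Fin 4), gθ z = g (WithLp.toLp 2 (fun i => z (Equiv.swap (0 : Fin 4) 1 i)))) :
    ∀ z : EuclideanSpace ℝ (Fin 4), g z = gθ (WithLp.toLp 2 (fun i => z (Equiv.swap (0 : Fin 4) 1 i))) :=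
  fun z => by rw [hθ, swapE_swapE]

/-- On the rescaled lattice the mirror relation reads `gθ (a x) = g (a (x ∘ swap))`. [folklore] -/
theorem mirror_lattice {g gθ : 𝓢(EuclideanSpace ℝ (Fin 4), ℝ)}
    (hθ : ∀ z : EuclideanSpace ℝ (Fin 4), gθ z = g (WithLp.toLp 2 (fun i => z (Equiv.swap (0 : Fin 4) 1 i))))
    (a : ℝ) (x : Site 4) : gθ (a • siteToE x) = g (a • siteToE (x ∘ Equiv.swap (0 : Fin 4) 1)) := by
  rw [hθ, swapE_smul_siteToE]

/-- The topological support of the mirror image is carried into the support by the swap. [folklore] -/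
theorem mirror_tsupport {g gθ : 𝓢(EuclideanSpace ℝ (Fin 4), ℝ)}
    (hθ : ∀ z : EuclideanSpace ℝ (Fin 4), gθ z = g (WithLp.toLp 2 (fun i => z (Equiv.swap (0 : Fin 4) 1 i))))
    {z : EuclideanSpace ℝ (Fin 4)} (hz : z ∈ tsupport (gθ : EuclideanSpace ℝ (Fin 4) → ℝ)) :
    (WithLp.toLp 2 (fun i => z (Equiv.swap (0 : Fin 4) 1 i)) : EuclideanSpace ℝ (Fin 4)) ∈
      tsupport (g : EuclideanSpace ℝ (Fin 4) → ℝ) := by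
  have hfun : (gθ : EuclideanSpace ℝ (Fin 4) → ℝ) = (g : EuclideanSpace ℝ (Fin 4) → ℝ) ∘
      fun z : EuclideanSpace ℝ (Fin 4) =>
        (WithLp.toLp 2 (fun i => z (Equiv.swap (0 : Fin 4) 1 i)) : EuclideanSpace ℝ (Fin 4)) :=
    funext hθ
  rw [hfun] at hz
  exact tsupport_comp_subset_preimage (g : EuclideanSpace ℝ (Fin 4) → ℝ)
    (LinearIsometryEquiv.piLpCongrLeft 2 ℝ ℝ (Equiv.swap (0 : Fin 4) 1)).continuous hz

/-- The mirror image of a function supported in `{z 0 − z 1 ≤ −δ}` is supported in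
`{δ ≤ z 0 − z 1}`. [folklore] -/
theorem mirror_halfspace {g gθ : 𝓢(EuclideanSpace ℝ (Fin 4), ℝ)}
    (hθ : ∀ z : EuclideanSpace ℝ (Fin 4), gθ z = g (WithLp.toLp 2 (fun i => z (Equiv.swap (0 : Fin 4) 1 i))))
    {δ : ℝ} (hg : ∀ z ∈ tsupport (g : EuclideanSpace ℝ (Fin 4) → ℝ), z 0 - z 1 ≤ -δ) :
    ∀ z ∈ tsupport (gθ : EuclideanSpace ℝ (Fin 4) → ℝ), δ ≤ z 0 - z 1 := by
  intro z hz
  have h := hg _ (mirror_tsupport hθ hz)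
  simp only [Equiv.swap_apply_left, Equiv.swap_apply_right] at h
  linarith

/-- The mirror image of a function supported in `B̄(0, T)` is supported in `B̄(0, T)` (the swap is
an isometry). [folklore] -/
theorem mirror_ball {g gθ : 𝓢(EuclideanSpace ℝ (Fin 4), ℝ)}
    (hθ : ∀ z : EuclideanSpace ℝ (Fin 4), gθ z = g (WithLp.toLp 2 (fun i => z (Equiv.swap (0 : Fin 4) 1 i))))
    {T : ℝ} (hg : tsupport (g : EuclideanSpace ℝ (Fin 4) → ℝ) ⊆ Metric.closedBall 0 T) :
    tsupport (gθ : EuclideanSpace ℝ (Fin 4) → ℝ) ⊆ Metric.closedBall 0 T := by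
  intro z hz
  have h := hg (mirror_tsupport hθ hz)
  rw [mem_closedBall_zero_iff] at h ⊢
  rwa [← (LinearIsometryEquiv.piLpCongrLeft 2 ℝ ℝ (Equiv.swap (0 : Fin 4) 1)).norm_map z]

/-! ## Bounds -/

/-- From `s² ≤ |u| |v|` conclude `|s| ≤ max |u| |v|`. [folklore] -/
theorem abs_le_max_of_sq_le {s u v : ℝ} (h : s ^ 2 ≤ |u| * |v|) : |s| ≤ max |u| |v| := by
  refine abs_le_of_sq_le_sq (h.trans ?_) (le_max_of_le_left (abs_nonneg u))
  rw [sq]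
  exact mul_le_mul (le_max_left _ _) (le_max_right _ _) (abs_nonneg _)
    ((abs_nonneg u).trans (le_max_left _ _))

/-! ## Torus versus infinite volume along the scheme -/

section Transfer

variable {G : Type} [Group G] [TopologicalSpace G] [IsTopologicalGroup G] [CompactSpace G]
  [MeasurableSpace G] [BorelSpace G]

/-- **Transfer.** Along the scheme, for test functions supported in `B̄(0, T)`, the truncated
renormalised lattice two-point function on the torus and its infinite-volume model
`c_k² a_k⁸ ΣΣ f(a x) h(a y) (P(y − x) − q²)` have the same asymptotics:
their difference tends to `0` (`TorusInfiniteVolumeComparison` + the sub-extensive rate + the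
lattice point count). [folklore] -/
theorem tendsto_torus_sub_infiniteVolume (r : LatticeRep G) (sch : SpeciesScheme (YMSpecies G))
    (β' : ℝ) (hβ'4 : β' < betaOne 4 r.ρ / 4) (h0 : ∀ k, 0 ≤ sch.β k)
    (hβ : ∀ᶠ k in atTop, sch.β k ≤ β')
    (hrate : ∀ κ T : ℝ, 0 < κ → Tendsto (fun k : ℕ => sch.c r.curvature k ^ 2 *
      Real.exp (-(κ * ((sch.L k : ℝ) - T / sch.a k)))) atTop (𝓝 0))
    (q : ℝ → ℝ) (P : ℝ → Site 4 → ℝ)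
    (hF5 : ∀ β : ℝ, 0 ≤ β → β ≤ β' →
      (∀ x : Site 4, HasBoxLimit (fun Λ => zdExpect r.ρ β Λ
        (r.curvature.F ∘ ZdGaugeConfig.translate x)) (q β)) ∧
      (∀ x y : Site 4, HasBoxLimit (fun Λ => zdExpect r.ρ β Λ (fun U =>
        r.curvature.F (ZdGaugeConfig.translate x U) * r.curvature.F (ZdGaugeConfig.translate y U)))
        (P β (y - x))))
    (μ' : ℝ) (Afs : ℕ → ℝ) (hμ' : 0 < μ')
    (hFS : ∀ (n : ℕ) (B : Finset (Site 4 × Fin 4)) (R : ℕ), B.card ≤ n →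
      (∀ e ∈ B, e.1 ∈ box 4 R) → ∀ (F : ZdGaugeConfig 4 G → ℝ), Measurable F → (∀ U, |F U| ≤ 1) →
      DependsOn F (B : Set (Site 4 × Fin 4)) → ∀ (β gβ : ℝ), |β| < betaOne 4 r.ρ / 4 →
      HasBoxLimit (fun Λ => zdExpect r.ρ β Λ F) gβ → ∀ L : ℕ, R < L →
      |wilsonExpectation (d := 4) (L := 2 * L + 1) r.ρ β (toTorusObservable (2 * L + 1) F) - gβ| ≤
        Afs n * Real.exp (-(μ' * ((L : ℝ) - R))))
    (T : ℝ) (hT : 0 < T) (f h : 𝓢(EuclideanSpace ℝ (Fin 4), ℝ))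
    (hf : tsupport (f : EuclideanSpace ℝ (Fin 4) → ℝ) ⊆ Metric.closedBall 0 T)
    (hh : tsupport (h : EuclideanSpace ℝ (Fin 4) → ℝ) ⊆ Metric.closedBall 0 T) :
    Tendsto (fun k : ℕ =>
      latticeSchwinger r.ρ sch (fun s => s.F) k 2 (fun _ => r.curvature) ![f, h] -
        latticeSchwinger r.ρ sch (fun s => s.F) k 1 (fun _ => r.curvature) (fun _ => f) *
          latticeSchwinger r.ρ sch (fun s => s.F) k 1 (fun _ => r.curvature) (fun _ => h) -
        sch.c r.curvature k ^ 2 * (sch.a k ^ 8 * ∑ x ∈ box 4 (sch.L k), ∑ y ∈ box 4 (sch.L k),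
          f (sch.a k • siteToE x) * h (sch.a k • siteToE y) *
            (P (sch.β k) (y - x) - q (sch.β k) ^ 2))) atTop (𝓝 0) := by
  obtain ⟨K, hK⟩ := TorusInfiniteVolumeComparison G r sch μ' Afs hμ' hFS
  obtain ⟨Mf, hMf⟩ := exists_abs_le_schwartz f
  obtain ⟨Mh, hMh⟩ := exists_abs_le_schwartz h
  set E : ℝ := max K 0 * ((3 * T) ^ 4 * Mf) * ((3 * T) ^ 4 * Mh) with hE
  -- eventually: strong coupling, fine mesh, large volume
  have hev : ∀ᶠ k in atTop, sch.β k ≤ β' ∧ sch.a k < min 1 T ∧ T + 3 ≤ sch.a k * sch.L k :=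
    hβ.and ((sch.tendsto_a.eventually_lt_const (lt_min one_pos hT)).and
      (sch.tendsto_L.eventually_ge_atTop (T + 3)))
  -- the bound in that regime
  have hbound : ∀ k, sch.β k ≤ β' → sch.a k < min 1 T → T + 3 ≤ sch.a k * sch.L k →
      |latticeSchwinger r.ρ sch (fun s => s.F) k 2 (fun _ => r.curvature) ![f, h] -
        latticeSchwinger r.ρ sch (fun s => s.F) k 1 (fun _ => r.curvature) (fun _ => f) *
          latticeSchwinger r.ρ sch (fun s => s.F) k 1 (fun _ => r.curvature) (fun _ => h) -
        sch.c r.curvature k ^ 2 * (sch.a k ^ 8 * ∑ x ∈ box 4 (sch.L k), ∑ y ∈ box 4 (sch.L k),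
          f (sch.a k • siteToE x) * h (sch.a k • siteToE y) *
            (P (sch.β k) (y - x) - q (sch.β k) ^ 2))| ≤
        (sch.c r.curvature k ^ 2 * Real.exp (-(μ' * ((sch.L k : ℝ) - (T + 2) / sch.a k)))) * E := by
    intro k hβk hak hLk
    have ha := sch.a_pos k
    have ha1 : sch.a k < 1 := hak.trans_le (min_le_left _ _)
    have haT : sch.a k < T := hak.trans_le (min_le_right _ _)
    have hβabs : |sch.β k| < betaOne 4 r.ρ / 4 :=
      abs_lt.2 ⟨by linarith [h0 k], hβk.trans_lt hβ'4⟩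
    have hTL : T / sch.a k + 2 < sch.L k := by
      rw [show T / sch.a k + 2 = (T + 2 * sch.a k) / sch.a k by field_simp, div_lt_iff₀ ha]
      nlinarith
    have hcmp := hK k (q (sch.β k)) (P (sch.β k)) hβabs (hF5 _ (h0 k) hβk).1 (hF5 _ (h0 k) hβk).2
      T f h hT hf hh hTL
    have hexp : Real.exp (-(μ' * ((sch.L k : ℝ) - (T / sch.a k + 2)))) ≤
        Real.exp (-(μ' * ((sch.L k : ℝ) - (T + 2) / sch.a k))) := by
      refine Real.exp_le_exp.2 (neg_le_neg (mul_le_mul_of_nonneg_left ?_ hμ'.le))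
      have h2 : (2 : ℝ) ≤ 2 / sch.a k := by
        rw [le_div_iff₀ ha]; nlinarith
      rw [add_div]
      linarith
    have hRf := SemiDegenerate.latticeSum_le_of_tsupport_subset_closedBall' hf hMf ha haT.le (sch.L k)
    have hRh := SemiDegenerate.latticeSum_le_of_tsupport_subset_closedBall' hh hMh ha haT.le (sch.L k)
    refine hcmp.trans ?_
    calc sch.c r.curvature k ^ 2 * K * Real.exp (-(μ' * ((sch.L k : ℝ) - (T / sch.a k + 2)))) *
          ((sch.a k ^ 4 * ∑ x ∈ box 4 (sch.L k), |f (sch.a k • siteToE x)|) *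
            (sch.a k ^ 4 * ∑ y ∈ box 4 (sch.L k), |h (sch.a k • siteToE y)|))
        ≤ sch.c r.curvature k ^ 2 * max K 0 * Real.exp (-(μ' * ((sch.L k : ℝ) - (T + 2) / sch.a k))) *
          (((3 * T) ^ 4 * Mf) * ((3 * T) ^ 4 * Mh)) := by
          gcongr
          · exact le_max_left _ _
          · exact (mul_nonneg (by positivity) (by positivity)).trans hRf
      _ = (sch.c r.curvature k ^ 2 * Real.exp (-(μ' * ((sch.L k : ℝ) - (T + 2) / sch.a k)))) * E := by
          rw [hE]; ring
  -- conclude: `c_k² e^{−μ'(L_k − (T+2)/a_k)} · E → 0`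
  have hlim := (hrate μ' (T + 2) hμ').mul_const E
  rw [zero_mul] at hlim
  refine squeeze_zero_norm' (hev.mono fun k hk => ?_) hlim
  rw [Real.norm_eq_abs]
  exact hbound k hk.1 hk.2.1 hk.2.2

end Transfer

end SwapOffDiag

open SwapOffDiag in
/-- **Brick `SwapOffDiagonalVanishing`** (REGISTERED signature — do not change): given that the
truncated renormalised lattice two-point function of the curvature vanishes in the limit on every
mirror pair `(g ∘ swap, g)` across the diagonal `{z 0 = z 1}` (hypothesis `hA`), it vanishes on every
pair `(f₀, f₁)` separated by that diagonal.  See the module docstring for the proof (mirror images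
as Schwartz maps; transfer torus ↔ infinite volume; Cauchy–Schwarz for the reflection-positive form
of the infinite-volume strong-coupling state). [folklore] -/
theorem SwapOffDiagonalVanishing : ∀ (G : Type) [Group G] [TopologicalSpace G] [IsTopologicalGroup G] [CompactSpace G] [MeasurableSpace G] [BorelSpace G] (r : Literature.MathematicalPhysics.QuantumFieldTheory.LatticeRep G) (sch : Literature.MathematicalPhysics.QuantumFieldTheory.SpeciesScheme (Literature.MathematicalPhysics.QuantumFieldTheory.YMSpecies G)) (β' : ℝ), 0 < β' → β' < betaOne 4 r.ρ / 4 → (∀ k, 0 ≤ sch.β k) → (∀ᶠ k in Filter.atTop, sch.β k ≤ β') → (∀ κ T : ℝ, 0 < κ → Filter.Tendsto (fun k : ℕ => sch.c r.curvature k ^ 2 * Real.exp (-(κ * ((sch.L k : ℝ) - T / sch.a k)))) Filter.atTop (nhds 0)) → ∀ (m A : ℝ) (q : ℝ → ℝ) (P : ℝ → Literature.Probability.LatticeModels.Site 4 → ℝ), 0 < m → (∀ β : ℝ, 0 ≤ β → β ≤ β' → (∀ x : Literature.Probability.LatticeModels.Site 4, Literature.Probability.LatticeModels.HasBoxLimit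 (fun Λ => Literature.MathematicalPhysics.QuantumFieldTheory.zdExpect r.ρ β Λ (r.curvature.F ∘ Literature.MathematicalPhysics.QuantumFieldTheory.ZdGaugeConfig.translate x)) (q β)) ∧ (∀ x y : Literature.Probability.LatticeModels.Site 4, Literature.Probability.LatticeModels.HasBoxLimit (fun Λ => Literature.MathematicalPhysics.QuantumFieldTheory.zdExpect r.ρ β Λ (fun U => r.curvature.F (Literature.MathematicalPhysics.QuantumFieldTheory.ZdGaugeConfig.translate x U) * r.curvature.F (Literature.MathematicalPhysics.QuantumFieldTheory.ZdGaugeConfig.translate y U))) (P β (y - x))) ∧ ∀ z : Literature.Probability.LatticeModels.Site 4, |P β z - q β ^ 2| ≤ A * Real.exp (-(m * ‖z‖))) → ∀ (μ' : ℝ) (Afs : ℕ → ℝ), 0 < μ' → (∀ (n : ℕ) (B : Finset (Literature.MathematicalPhysics.QuantumLattice.ZdEdge 4)) (R : ℕ), B.card ≤ n → (∀ e ∈ B, e.1 ∈ Literature.Probability.LatticeModels.box 4 R) → ∀ (F : Literature.MathematicalPhysics.QuantumFieldTheory.ZdGaugeConfig 4 G → ℝ), Measurable F → (∀ U, |F U|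 ≤ 1) → DependsOn F (B : Set (Literature.MathematicalPhysics.QuantumLattice.ZdEdge 4)) → ∀ (β gβ : ℝ), |β| < betaOne 4 r.ρ / 4 → Literature.Probability.LatticeModels.HasBoxLimit (fun Λ => Literature.MathematicalPhysics.QuantumFieldTheory.zdExpect r.ρ β Λ F) gβ → ∀ L : ℕ, R < L → |Literature.MathematicalPhysics.QuantumFieldTheory.wilsonExpectation (d := 4) (L := 2 * L + 1) r.ρ β (Literature.MathematicalPhysics.QuantumLattice.toTorusObservable (2 * L + 1) F) - gβ| ≤ Afs n * Real.exp (-(μ' * ((L : ℝ) - R)))) → (∀ (δ T : ℝ) (g gθ : SchwartzMap (EuclideanSpace ℝ (Fin 4)) ℝ), 0 < δ → 0 < T → (∀ z ∈ tsupport (g : EuclideanSpace ℝ (Fin 4) → ℝ), δ ≤ z 0 - z 1) → tsupport (g : EuclideanSpace ℝ (Fin 4) → ℝ) ⊆ Metric.closedBall 0 T → (∀ z : EuclideanSpace ℝ (Fin 4), gθ z = g (WithLp.toLp 2 (fun i => z (Equiv.swap (0 : Fin 4) 1 i)))) → Filter.Tendsto (fun k : ℕ => Literature.MathematicalPhysics.QuantumFieldTheory.latticeSchwinger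 r.ρ sch (fun s => s.F) k 2 (fun _ => r.curvature) ![gθ, g] - Literature.MathematicalPhysics.QuantumFieldTheory.latticeSchwinger r.ρ sch (fun s => s.F) k 1 (fun _ => r.curvature) (fun _ => gθ) * Literature.MathematicalPhysics.QuantumFieldTheory.latticeSchwinger r.ρ sch (fun s => s.F) k 1 (fun _ => r.curvature) (fun _ => g)) Filter.atTop (nhds 0)) → ∀ (δ T : ℝ) (f₀ f₁ : SchwartzMap (EuclideanSpace ℝ (Fin 4)) ℝ), 0 < δ → 0 < T → (∀ z ∈ tsupport (f₀ : EuclideanSpace ℝ (Fin 4) → ℝ), z 0 - z 1 ≤ -δ) → (∀ z ∈ tsupport (f₁ : EuclideanSpace ℝ (Fin 4) → ℝ), δ ≤ z 0 - z 1) → tsupport (f₀ : EuclideanSpace ℝ (Fin 4) → ℝ) ⊆ Metric.closedBall 0 T → tsupport (f₁ : EuclideanSpace ℝ (Fin 4) → ℝ) ⊆ Metric.closedBall 0 T → Filter.Tendsto (fun k : ℕ => Literature.MathematicalPhysics.QuantumFieldTheory.latticeSchwinger r.ρ sch (fun s => s.F) k 2 (fun _ => r.curvature) ![f₀, f₁]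 - Literature.MathematicalPhysics.QuantumFieldTheory.latticeSchwinger r.ρ sch (fun s => s.F) k 1 (fun _ => r.curvature) (fun _ => f₀) * Literature.MathematicalPhysics.QuantumFieldTheory.latticeSchwinger r.ρ sch (fun s => s.F) k 1 (fun _ => r.curvature) (fun _ => f₁)) Filter.atTop (nhds 0) := by
  intro G _ _ _ _ _ _ r sch β' _ hβ'4 h0 hβ hrate m A q P _ hF5 μ' Afs hμ' hFS hA δ T f₀ f₁ hδ hT
    hs₀ hs₁ hb₀ hb₁
  have hF5' : ∀ β : ℝ, 0 ≤ β → β ≤ β' →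
      (∀ x : Site 4, HasBoxLimit (fun Λ => zdExpect r.ρ β Λ
        (r.curvature.F ∘ ZdGaugeConfig.translate x)) (q β)) ∧
      (∀ x y : Site 4, HasBoxLimit (fun Λ => zdExpect r.ρ β Λ (fun U =>
        r.curvature.F (ZdGaugeConfig.translate x U) * r.curvature.F (ZdGaugeConfig.translate y U)))
        (P β (y - x))) := fun β h1 h2 => ⟨(hF5 β h1 h2).1, (hF5 β h1 h2).2.1⟩
  -- (1) the mirror images `f₀θ = f₀ ∘ swap`, `f₁θ = f₁ ∘ swap`
  obtain ⟨f₀θ, hf₀θ⟩ := exists_schwartz_swap f₀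
  obtain ⟨f₁θ, hf₁θ⟩ := exists_schwartz_swap f₁
  have hs₀θ : ∀ z ∈ tsupport (f₀θ : EuclideanSpace ℝ (Fin 4) → ℝ), δ ≤ z 0 - z 1 :=
    mirror_halfspace hf₀θ hs₀
  have hb₀θ : tsupport (f₀θ : EuclideanSpace ℝ (Fin 4) → ℝ) ⊆ Metric.closedBall 0 T :=
    mirror_ball hf₀θ hb₀
  have hb₁θ : tsupport (f₁θ : EuclideanSpace ℝ (Fin 4) → ℝ) ⊆ Metric.closedBall 0 T :=
    mirror_ball hf₁θ hb₁
  -- the diagonal pairs vanish on the torus (hypothesis `hA`)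
  have hA₁ := hA δ T f₁ f₁θ hδ hT hs₁ hb₁ hf₁θ
  have hA₀ := hA δ T f₀θ f₀ hδ hT hs₀θ hb₀θ (mirror_symm hf₀θ)
  -- (2) transfer torus ↔ infinite volume for the three pairs
  have hc₀₁ := tendsto_torus_sub_infiniteVolume r sch β' hβ'4 h0 hβ hrate q P hF5' μ' Afs hμ' hFS T hT
    f₀ f₁ hb₀ hb₁
  have hc₁₁ := tendsto_torus_sub_infiniteVolume r sch β' hβ'4 h0 hβ hrate q P hF5' μ' Afs hμ' hFS T hT
    f₁θ f₁ hb₁θ hb₁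
  have hc₀₀ := tendsto_torus_sub_infiniteVolume r sch β' hβ'4 h0 hβ hrate q P hF5' μ' Afs hμ' hFS T hT
    f₀ f₀θ hb₀ hb₀θ
  -- the infinite-volume diagonal quantities vanish in the limit
  have hu := hA₁.sub hc₁₁
  have hv := hA₀.sub hc₀₀
  simp only [sub_sub_cancel, sub_zero] at hu hv
  -- (3) Cauchy–Schwarz in the infinite volume, eventually
  have hev : ∀ᶠ k in atTop, sch.β k ≤ β' ∧ sch.a k ≤ δ :=
    hβ.and (sch.tendsto_a.eventually_le_const hδ)
  have hCS : ∀ᶠ k in atTop,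
      (sch.c r.curvature k ^ 2 * (sch.a k ^ 8 * ∑ x ∈ box 4 (sch.L k), ∑ y ∈ box 4 (sch.L k),
        f₀ (sch.a k • siteToE x) * f₁ (sch.a k • siteToE y) *
          (P (sch.β k) (y - x) - q (sch.β k) ^ 2))) ^ 2 ≤
      |sch.c r.curvature k ^ 2 * (sch.a k ^ 8 * ∑ x ∈ box 4 (sch.L k), ∑ y ∈ box 4 (sch.L k),
        f₁θ (sch.a k • siteToE x) * f₁ (sch.a k • siteToE y) *
          (P (sch.β k) (y - x) - q (sch.β k) ^ 2))| *
      |sch.c r.curvature k ^ 2 * (sch.a k ^ 8 * ∑ x ∈ box 4 (sch.L k), ∑ y ∈ box 4 (sch.L k),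
        f₀ (sch.a k • siteToE x) * f₀θ (sch.a k • siteToE y) *
          (P (sch.β k) (y - x) - q (sch.β k) ^ 2))| := by
    refine hev.mono fun k hk => ?_
    have h := SwapOffDiagonalInfiniteVolumeCS G r (sch.L k) (sch.a k) δ (sch.β k) (sch.a_pos k) hk.2
      (h0 k) (q (sch.β k)) (P (sch.β k)) (hF5' _ (h0 k) hk.1).1 (hF5' _ (h0 k) hk.1).2 f₀ f₀θ f₁ f₁θ
      hs₀θ hs₁ (fun x => (mirror_symm hf₀θ _).trans (by rw [swapE_smul_siteToE]))
      (mirror_lattice hf₁θ (sch.a k))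
    rw [← abs_mul]
    refine le_trans ?_ (le_abs_self _)
    calc _ = (sch.c r.curvature k ^ 2) ^ 2 * (sch.a k ^ 8 * ∑ x ∈ box 4 (sch.L k),
          ∑ y ∈ box 4 (sch.L k), f₀ (sch.a k • siteToE x) * f₁ (sch.a k • siteToE y) *
            (P (sch.β k) (y - x) - q (sch.β k) ^ 2)) ^ 2 := by ring
      _ ≤ (sch.c r.curvature k ^ 2) ^ 2 * ((sch.a k ^ 8 * ∑ x ∈ box 4 (sch.L k),
          ∑ y ∈ box 4 (sch.L k), f₁θ (sch.a k • siteToE x) * f₁ (sch.a k • siteToE y) *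
            (P (sch.β k) (y - x) - q (sch.β k) ^ 2)) * (sch.a k ^ 8 * ∑ x ∈ box 4 (sch.L k),
          ∑ y ∈ box 4 (sch.L k), f₀ (sch.a k • siteToE x) * f₀θ (sch.a k • siteToE y) *
            (P (sch.β k) (y - x) - q (sch.β k) ^ 2))) :=
          mul_le_mul_of_nonneg_left h (by positivity)
      _ = _ := by ring
  -- hence the infinite-volume off-diagonal quantity vanishes in the limit
  have hmax := hu.abs.max hv.abs
  rw [abs_zero, max_self] at hmax
  have hs : Tendsto (fun k : ℕ => sch.c r.curvature k ^ 2 * (sch.a k ^ 8 *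
      ∑ x ∈ box 4 (sch.L k), ∑ y ∈ box 4 (sch.L k),
        f₀ (sch.a k • siteToE x) * f₁ (sch.a k • siteToE y) *
          (P (sch.β k) (y - x) - q (sch.β k) ^ 2))) atTop (𝓝 0) := by
    refine squeeze_zero_norm' (hCS.mono fun k hk => ?_) hmax
    rw [Real.norm_eq_abs]
    exact abs_le_max_of_sq_le hk
  -- and so does the torus quantity
  have hfin := hc₀₁.add hs
  simp only [sub_add_cancel, add_zero] at hfin
  exact hfin

end Summit.QuantumFields.YangMills.Theorems.CurvatureKernel

end
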